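import Literature.MathematicalPhysics.KineticTheory.HardSphereEulerProofs
import Literature.Analysis.FluidPDE.HardSphereTorusMeasure

/-!
# Exact normalisation of the cone mollifier: `∫ b_r(y, ·) = 1` on `𝕋³` for `0 < r < 1/2`

Support for the crux `JParityClosure.LocalSecondLaw` (stmt-AtomisticToContinuum-13081; standing disprover's
`Cruxes/LocalSecondLaw/Disproof.lean`).  The crux mollifies the empirical fields with the cone kernel
`b_r(y, x₀) = 3/(πr³) (1 - d(y,x₀)/r)₊` (minimal-image distance); every identification of limits `ρ_r → b_r * ρ`
needs its exact mass.  Layer cake (`lintegral_eq_lintegral_meas_lt`): the superlevel sets of the hat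
`(1 - d/r)₊` are minimal-image balls of radius `r(1-t)`, of Haar volume `(4π/3) r³ (1-t)³`
(`Torus.volume_euclidDist_lt`, `EuclideanSpace.volume_ball_fin_three`), and `∫₀¹ (1-t)³ dt = 1/4`, so
`∫ (1 - d/r)₊ = π r³/3` (`lintegral_hat`) and `∫ b_r = 1` (`integral_cone_eq_one`).  The sibling
`DensityCap/Negative/MollifiedDensity.lean` only has the lower bound `coneMass ≥ 3/(16π)`.  refuter-cdisprove-stmt-AtomisticToContinuum-13081-0.
-/

noncomputable section

namespace Summit.AtomisticToContinuum.HydrodynamicLimit.Theorems.LocalSecondLawNegative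

open MeasureTheory Filter Set Topology
open scoped ENNReal
open Literature.MathematicalPhysics.KineticTheory Literature.Analysis.FluidPDE

variable {N : ℕ}

/-- The hat profile `(1 - d(x₀,y)/r)₊`. [folklore] -/
def hat (r : ℝ) (y x₀ : T3) : ℝ := max (1 - Torus.euclidDist y x₀ / r) 0

/-- The hat is non-negative. [folklore] -/
theorem hat_nonneg (r : ℝ) (y x₀ : T3) : 0 ≤ hat r y x₀ := le_max_right _ _

/-- The hat is at most one. [folklore] -/
theorem hat_le_one {r : ℝ} (hr : 0 < r) (y x₀ : T3) : hat r y x₀ ≤ 1 := by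
  unfold hat
  refine max_le ?_ zero_le_one
  have : 0 ≤ Torus.euclidDist y x₀ / r := by rw [Torus.euclidDist_eq]; positivity
  linarith

/-- The hat is continuous in the field point. [folklore] -/
theorem continuous_hat (r : ℝ) (y : T3) : Continuous (hat r y) := by
  unfold hat
  refine (continuous_const.sub (Continuous.div_const ?_ _)).max continuous_const
  show Continuous fun x₀ => ‖Torus.reprSym (y - x₀)‖
  exact Torus.continuous_norm_reprSym.comp (continuous_const.sub continuous_id)

/-- Superlevel sets of the hat: `{t < hat} = {d < r(1-t)}` for `t > 0`. [folklore] -/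
theorem setOf_lt_hat {r : ℝ} (hr : 0 < r) (y : T3) {t : ℝ} (ht : 0 < t) :
    {x₀ : T3 | t < hat r y x₀} = {x₀ | Torus.euclidDist x₀ y < r * (1 - t)} := by
  ext x₀
  simp only [Set.mem_setOf_eq, hat, lt_max_iff, Torus.euclidDist_comm x₀ y]
  constructor
  · rintro (h | h)
    · rw [lt_sub_comm, div_lt_iff₀ hr] at h; linarith
    · linarith
  · intro h
    left
    rw [lt_sub_comm, div_lt_iff₀ hr]; linarith

/-- Layer-cake evaluation: `∫⁻ (1 - d/r)₊ = π r³/3` for `0 < r < 1/2`. [folklore] -/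
theorem lintegral_hat {r : ℝ} (hr : 0 < r) (hr2 : r < 1 / 2) (y : T3) :
    ∫⁻ x₀, ENNReal.ofReal (hat r y x₀) = ENNReal.ofReal (Real.pi * r ^ 3 / 3) := by
  rw [lintegral_eq_lintegral_meas_lt volume (Eventually.of_forall (hat_nonneg r y))
    (continuous_hat r y).measurable.aemeasurable]
  have hslice : ∀ t ∈ Ioi (0 : ℝ), volume {x₀ : T3 | t < hat r y x₀} =
      ENNReal.ofReal (4 * Real.pi / 3 * (r * (1 - t)) ^ 3) := by
    intro t ht
    have ht' : (0 : ℝ) < t := ht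
    rw [setOf_lt_hat hr y ht', Torus.volume_euclidDist_lt (by nlinarith) y,
      EuclideanSpace.volume_ball_fin_three]
    by_cases h1 : t ≤ 1
    · have hrt : 0 ≤ r * (1 - t) := by nlinarith
      rw [← ENNReal.ofReal_pow hrt, ← ENNReal.ofReal_mul (by positivity)]
      congr 1; ring
    · have hrt : r * (1 - t) < 0 := by nlinarith
      rw [ENNReal.ofReal_of_nonpos hrt.le, zero_pow three_ne_zero, zero_mul,
        ENNReal.ofReal_of_nonpos]
      have : (r * (1 - t)) ^ 3 ≤ 0 := by
        have := hrt; nlinarith [sq_nonneg (r * (1 - t))]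
      nlinarith [Real.pi_pos]
  rw [setLIntegral_congr_fun measurableSet_Ioi hslice]
  -- split at t = 1: the integrand vanishes on (1, ∞)
  have hsplit : ∫⁻ t in Ioi (0 : ℝ), ENNReal.ofReal (4 * Real.pi / 3 * (r * (1 - t)) ^ 3) =
      ∫⁻ t in Ioc (0 : ℝ) 1, ENNReal.ofReal (4 * Real.pi / 3 * (r * (1 - t)) ^ 3) := by
    rw [← Ioc_union_Ioi_eq_Ioi zero_le_one, lintegral_union measurableSet_Ioi
      (Set.disjoint_left.2 fun t ht ht' => not_lt.2 ht.2 ht')]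
    have h0 : ∫⁻ t in Ioi (1 : ℝ), ENNReal.ofReal (4 * Real.pi / 3 * (r * (1 - t)) ^ 3) = 0 := by
      refine (setLIntegral_congr_fun measurableSet_Ioi fun t (ht : 1 < t) => ?_).trans
        (lintegral_zero)
      refine ENNReal.ofReal_of_nonpos ?_
      have hrt : r * (1 - t) < 0 := by nlinarith
      have : (r * (1 - t)) ^ 3 ≤ 0 := by nlinarith [sq_nonneg (r * (1 - t))]
      nlinarith [Real.pi_pos]
    rw [h0, add_zero]
  rw [hsplit]
  have hint : IntegrableOn (fun t : ℝ => 4 * Real.pi / 3 * (r * (1 - t)) ^ 3) (Ioc 0 1) :=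
    (by fun_prop : Continuous fun t : ℝ => 4 * Real.pi / 3 * (r * (1 - t)) ^ 3).integrableOn_Icc.mono_set
      Ioc_subset_Icc_self
  have hnn : 0 ≤ᵐ[volume.restrict (Ioc (0 : ℝ) 1)] fun t : ℝ => 4 * Real.pi / 3 * (r * (1 - t)) ^ 3 := by
    refine ae_restrict_of_forall_mem measurableSet_Ioc fun t ht => ?_
    have : 0 ≤ r * (1 - t) := by nlinarith [ht.2]
    positivity
  rw [← ofReal_integral_eq_lintegral_ofReal hint hnn]
  congr 1
  rw [← intervalIntegral.integral_of_le zero_le_one]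
  have hcomp : ∫ t in (0 : ℝ)..1, 4 * Real.pi / 3 * (r * (1 - t)) ^ 3 =
      4 * Real.pi / 3 * r ^ 3 * ∫ t in (0 : ℝ)..1, (1 - t) ^ 3 := by
    rw [← intervalIntegral.integral_const_mul]
    refine intervalIntegral.integral_congr fun t _ => ?_
    ring
  rw [hcomp, intervalIntegral.integral_comp_sub_left (fun t : ℝ => t ^ 3) 1, sub_self, sub_zero,
    integral_pow]
  ring

/-- **Exact normalisation of the cone mollifier**: `∫ b_r(y, ·) = 1` for `0 < r < 1/2`. [folklore] -/
theorem integral_cone_eq_one {r : ℝ} (hr : 0 < r) (hr2 : r < 1 / 2) (y : T3) :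
    ∫ x₀, 3 / (Real.pi * r ^ 3) * max (1 - Torus.euclidDist y x₀ / r) 0 = 1 := by
  rw [integral_const_mul]
  have h : ∫ x₀, max (1 - Torus.euclidDist y x₀ / r) 0 = Real.pi * r ^ 3 / 3 := by
    change ∫ x₀, hat r y x₀ = _
    rw [integral_eq_lintegral_of_nonneg_ae (Eventually.of_forall (hat_nonneg r y))
      (continuous_hat r y).measurable.aestronglyMeasurable, lintegral_hat hr hr2 y,
      ENNReal.toReal_ofReal (by positivity)]
  rw [h]
  field_simp



end Summit.AtomisticToContinuum.HydrodynamicLimit.Theorems.LocalSecondLawNegative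

end
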